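import Summits.Ventures.LatticeQCDFlow.Scoring.TransposeConjugationCommutant
import Summits.Ventures.LatticeQCDFlow.Scoring.UNOnePlaquetteTwoPoint
import HarnessLib

/-!
# The one-plaquette congruence channel of `U(N)`: `∫ (u X uᵀ)_{ab} e^{βRe tr u} du = A'·X_{ab} + B'·X_{ba}`

HONEST FRAMING: exact (Metropolis-corrected) sampling algorithms for lattice gauge theory;
figures of merit are autocorrelation/cost numbers at stated couplings and volumes; no
continuum-physics claim.

Venture `LatticeQCDFlow` (cell pub-lqcd), sub-topic `Scoring`; FANOUT row 5 (`s0-sun-a`), GEN-21.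
NEW WORK of the cell (placement rule).  The `u ⊗ u` companion of GEN-20's `UNOnePlaquetteTwoPoint` (the
`u ⊗ ū` channel `∫ (u X u*) e^{βRe tr u} du = A·X + B·tr(X)·1`): for `N ≥ 2`, every real `β` and every `X ∈ M_N(ℂ)`,

  **`∫_{U(N)} (u X uᵀ)_{ab} e^{βRe tr u} du = A'·X_{ab} + B'·X_{ba}`**,
  `A' = (N·s₁ − s₂)/(N(N² − 1))`, `B' = (N·s₂ − s₁)/(N(N² − 1))`,
  `s₁ = ∫ (tr u)² e^{βRe tr u} du`, `s₂ = ∫ tr(u²) e^{βRe tr u} du`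

(so `A' + B' = (s₁ + s₂)/(N(N+1)) = ∫ χ_{Sym²} e^{βRe tr}/dim Sym²` and `A' − B' = (s₁ − s₂)/(N(N−1)) =
∫ χ_{Λ²} e^{βRe tr}/dim Λ²`: Schur's lemma on `ℂ^N ⊗ ℂ^N = Sym² ⊕ Λ²` in disguise).  Route: the entrywise
integral is a linear map `T` with `T(gXgᵀ) = g T(X) gᵀ` (substitute `u ↦ gug*`, `gᵀ(g*)ᵀ = 1`, class property
of the weight); GEN-21's `TransposeConjugationCommutant` gives `T = A'·id + B'·transpose`; the two trace
functionals `Σ_{jk} T(E_{jk})_{jk} = s₁`, `Σ_{jk} T(E_{jk})_{kj} = s₂` fix the constants.  It is the one-plaquette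
input of the exact moment `E (tr W_{R×T})²` of two-dimensional `U(N)` Wilson loops (sequel).

No `def`, nothing cited as a fact, 0 sorry.
-/

noncomputable section

open Real MeasureTheory Filter Topology Finset Matrix
open Complex (I)
open Literature.MathematicalPhysics.QuantumFieldTheory (haarProbability)
open Literature.Analysis.FunctionSpaces (besselI)

namespace Summit.Ventures.LatticeQCDFlow.Scoring

section CongruenceChannel

variable {N : ℕ}

/-! ### 1. The entrywise congruence integrals -/

/-- `u ↦ (u X uᵀ)_{ab} · e^{β Re tr u}` is integrable on `U(N)`. -/
theorem integrable_congr_entry_mul_weight (β : ℝ) (X : Matrix (Fin N) (Fin N) ℂ) (a b : Fin N) :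
    Integrable (fun u : Matrix.unitaryGroup (Fin N) ℂ => (((u : Matrix.unitaryGroup (Fin N) ℂ) : Matrix (Fin N) (Fin N) ℂ) * X *
      ((u : Matrix.unitaryGroup (Fin N) ℂ) : Matrix (Fin N) (Fin N) ℂ)ᵀ) a b *
      (Real.exp (β * ((u : Matrix.unitaryGroup (Fin N) ℂ) : Matrix (Fin N) (Fin N) ℂ).trace.re) : ℂ))
      (haarProbability (Matrix.unitaryGroup (Fin N) ℂ)) := by
  have hc : Continuous fun u : Matrix.unitaryGroup (Fin N) ℂ => (((u : Matrix.unitaryGroup (Fin N) ℂ) : Matrix (Fin N) (Fin N) ℂ) * X *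
      ((u : Matrix.unitaryGroup (Fin N) ℂ) : Matrix (Fin N) (Fin N) ℂ)ᵀ) a b *
      (Real.exp (β * ((u : Matrix.unitaryGroup (Fin N) ℂ) : Matrix (Fin N) (Fin N) ℂ).trace.re) : ℂ) := by
    refine (Continuous.matrix_elem ((continuous_subtype_val.matrix_mul continuous_const).matrix_mul
      (continuous_subtype_val.matrix_transpose)) a b).mul ?_
    exact Complex.continuous_ofReal.comp (Real.continuous_exp.comp (continuous_const.mul
      (Complex.continuous_re.comp (continuous_id.matrix_trace.comp continuous_subtype_val))))
  exact hc.integrable_of_hasCompactSupport (HasCompactSupport.of_compactSpace _)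

/-- **Congruence covariance**: `∫ (u (gXgᵀ) uᵀ)_{ab} e^{βRe tr u} du = Σ_{c,d} g_{ac} (∫ (uXuᵀ)_{cd} e^{βRe tr u} du) (gᵀ)_{db}`. -/
theorem integral_congr_entry_congr (β : ℝ) (X : Matrix (Fin N) (Fin N) ℂ) (g : Matrix.unitaryGroup (Fin N) ℂ) (a b : Fin N) :
    ∫ u, (((u : Matrix.unitaryGroup (Fin N) ℂ) : Matrix (Fin N) (Fin N) ℂ) * (((g : Matrix.unitaryGroup (Fin N) ℂ) : Matrix (Fin N) (Fin N) ℂ) * X *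
        ((g : Matrix.unitaryGroup (Fin N) ℂ) : Matrix (Fin N) (Fin N) ℂ)ᵀ) *
        ((u : Matrix.unitaryGroup (Fin N) ℂ) : Matrix (Fin N) (Fin N) ℂ)ᵀ) a b *
        (Real.exp (β * ((u : Matrix.unitaryGroup (Fin N) ℂ) : Matrix (Fin N) (Fin N) ℂ).trace.re) : ℂ) ∂(haarProbability (Matrix.unitaryGroup (Fin N) ℂ))
      = ∑ c, ∑ d, ((g : Matrix.unitaryGroup (Fin N) ℂ) : Matrix (Fin N) (Fin N) ℂ) a c *
          (∫ u, (((u : Matrix.unitaryGroup (Fin N) ℂ) : Matrix (Fin N) (Fin N) ℂ) * X * ((u : Matrix.unitaryGroup (Fin N) ℂ) : Matrix (Fin N) (Fin N) ℂ)ᵀ) c d *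
            (Real.exp (β * ((u : Matrix.unitaryGroup (Fin N) ℂ) : Matrix (Fin N) (Fin N) ℂ).trace.re) : ℂ) ∂(haarProbability (Matrix.unitaryGroup (Fin N) ℂ))) *
          (((g : Matrix.unitaryGroup (Fin N) ℂ) : Matrix (Fin N) (Fin N) ℂ)ᵀ) d b := by
  -- substitute `u ↦ g u g⁻¹`
  rw [← integral_conj_eq_self (fun u : Matrix.unitaryGroup (Fin N) ℂ => (((u : Matrix.unitaryGroup (Fin N) ℂ) : Matrix (Fin N) (Fin N) ℂ) *
      (((g : Matrix.unitaryGroup (Fin N) ℂ) : Matrix (Fin N) (Fin N) ℂ) * X * ((g : Matrix.unitaryGroup (Fin N) ℂ) : Matrix (Fin N) (Fin N) ℂ)ᵀ) *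
      ((u : Matrix.unitaryGroup (Fin N) ℂ) : Matrix (Fin N) (Fin N) ℂ)ᵀ) a b *
      (Real.exp (β * ((u : Matrix.unitaryGroup (Fin N) ℂ) : Matrix (Fin N) (Fin N) ℂ).trace.re) : ℂ)) g]
  have hg : star ((g : Matrix.unitaryGroup (Fin N) ℂ) : Matrix (Fin N) (Fin N) ℂ) * ((g : Matrix.unitaryGroup (Fin N) ℂ) : Matrix (Fin N) (Fin N) ℂ) = 1 :=
    Matrix.UnitaryGroup.star_mul_self g
  have hgT : (((g : Matrix.unitaryGroup (Fin N) ℂ) : Matrix (Fin N) (Fin N) ℂ)ᵀ) * (star ((g : Matrix.unitaryGroup (Fin N) ℂ) : Matrix (Fin N) (Fin N) ℂ))ᵀ = 1 := by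
    rw [← Matrix.transpose_mul, hg, Matrix.transpose_one]
  have hpt : ∀ u : Matrix.unitaryGroup (Fin N) ℂ,
      ((((g * u * g⁻¹ : Matrix.unitaryGroup (Fin N) ℂ)) : Matrix (Fin N) (Fin N) ℂ) *
        (((g : Matrix.unitaryGroup (Fin N) ℂ) : Matrix (Fin N) (Fin N) ℂ) * X * ((g : Matrix.unitaryGroup (Fin N) ℂ) : Matrix (Fin N) (Fin N) ℂ)ᵀ) *
        ((((g * u * g⁻¹ : Matrix.unitaryGroup (Fin N) ℂ)) : Matrix (Fin N) (Fin N) ℂ))ᵀ) a b *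
        (Real.exp (β * (((g * u * g⁻¹ : Matrix.unitaryGroup (Fin N) ℂ)) : Matrix (Fin N) (Fin N) ℂ).trace.re) : ℂ)
      = ∑ c, ∑ d, ((g : Matrix.unitaryGroup (Fin N) ℂ) : Matrix (Fin N) (Fin N) ℂ) a c *
          ((((u : Matrix.unitaryGroup (Fin N) ℂ) : Matrix (Fin N) (Fin N) ℂ) * X * ((u : Matrix.unitaryGroup (Fin N) ℂ) : Matrix (Fin N) (Fin N) ℂ)ᵀ) c d *
            (Real.exp (β * ((u : Matrix.unitaryGroup (Fin N) ℂ) : Matrix (Fin N) (Fin N) ℂ).trace.re) : ℂ)) *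
          (((g : Matrix.unitaryGroup (Fin N) ℂ) : Matrix (Fin N) (Fin N) ℂ)ᵀ) d b := by
    intro u
    rw [trace_conj_unitaryGroup]
    have hmat : (((g * u * g⁻¹ : Matrix.unitaryGroup (Fin N) ℂ)) : Matrix (Fin N) (Fin N) ℂ) *
        (((g : Matrix.unitaryGroup (Fin N) ℂ) : Matrix (Fin N) (Fin N) ℂ) * X * ((g : Matrix.unitaryGroup (Fin N) ℂ) : Matrix (Fin N) (Fin N) ℂ)ᵀ) *
        ((((g * u * g⁻¹ : Matrix.unitaryGroup (Fin N) ℂ)) : Matrix (Fin N) (Fin N) ℂ))ᵀ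
        = ((g : Matrix.unitaryGroup (Fin N) ℂ) : Matrix (Fin N) (Fin N) ℂ) * (((u : Matrix.unitaryGroup (Fin N) ℂ) : Matrix (Fin N) (Fin N) ℂ) * X *
          ((u : Matrix.unitaryGroup (Fin N) ℂ) : Matrix (Fin N) (Fin N) ℂ)ᵀ) * ((g : Matrix.unitaryGroup (Fin N) ℂ) : Matrix (Fin N) (Fin N) ℂ)ᵀ := by
      rw [show (((g * u * g⁻¹ : Matrix.unitaryGroup (Fin N) ℂ)) : Matrix (Fin N) (Fin N) ℂ)
          = ((g : Matrix.unitaryGroup (Fin N) ℂ) : Matrix (Fin N) (Fin N) ℂ) * ((u : Matrix.unitaryGroup (Fin N) ℂ) : Matrix (Fin N) (Fin N) ℂ) *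
            star ((g : Matrix.unitaryGroup (Fin N) ℂ) : Matrix (Fin N) (Fin N) ℂ) from rfl]
      rw [Matrix.transpose_mul, Matrix.transpose_mul]
      -- `(g u g*) (g X gᵀ) (g*)ᵀ uᵀ gᵀ = g u (g* g) X (gᵀ (g*)ᵀ) uᵀ gᵀ`
      calc ((g : Matrix.unitaryGroup (Fin N) ℂ) : Matrix (Fin N) (Fin N) ℂ) * ((u : Matrix.unitaryGroup (Fin N) ℂ) : Matrix (Fin N) (Fin N) ℂ) *
            star ((g : Matrix.unitaryGroup (Fin N) ℂ) : Matrix (Fin N) (Fin N) ℂ) *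
            (((g : Matrix.unitaryGroup (Fin N) ℂ) : Matrix (Fin N) (Fin N) ℂ) * X * ((g : Matrix.unitaryGroup (Fin N) ℂ) : Matrix (Fin N) (Fin N) ℂ)ᵀ) *
            ((star ((g : Matrix.unitaryGroup (Fin N) ℂ) : Matrix (Fin N) (Fin N) ℂ))ᵀ * (((u : Matrix.unitaryGroup (Fin N) ℂ) : Matrix (Fin N) (Fin N) ℂ)ᵀ *
              ((g : Matrix.unitaryGroup (Fin N) ℂ) : Matrix (Fin N) (Fin N) ℂ)ᵀ))
          = ((g : Matrix.unitaryGroup (Fin N) ℂ) : Matrix (Fin N) (Fin N) ℂ) * ((u : Matrix.unitaryGroup (Fin N) ℂ) : Matrix (Fin N) (Fin N) ℂ) *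
            (star ((g : Matrix.unitaryGroup (Fin N) ℂ) : Matrix (Fin N) (Fin N) ℂ) * ((g : Matrix.unitaryGroup (Fin N) ℂ) : Matrix (Fin N) (Fin N) ℂ)) * X *
            (((g : Matrix.unitaryGroup (Fin N) ℂ) : Matrix (Fin N) (Fin N) ℂ)ᵀ * (star ((g : Matrix.unitaryGroup (Fin N) ℂ) : Matrix (Fin N) (Fin N) ℂ))ᵀ) *
            (((u : Matrix.unitaryGroup (Fin N) ℂ) : Matrix (Fin N) (Fin N) ℂ)ᵀ * ((g : Matrix.unitaryGroup (Fin N) ℂ) : Matrix (Fin N) (Fin N) ℂ)ᵀ) := by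
            simp only [Matrix.mul_assoc]
        _ = ((g : Matrix.unitaryGroup (Fin N) ℂ) : Matrix (Fin N) (Fin N) ℂ) * (((u : Matrix.unitaryGroup (Fin N) ℂ) : Matrix (Fin N) (Fin N) ℂ) * X *
            ((u : Matrix.unitaryGroup (Fin N) ℂ) : Matrix (Fin N) (Fin N) ℂ)ᵀ) * ((g : Matrix.unitaryGroup (Fin N) ℂ) : Matrix (Fin N) (Fin N) ℂ)ᵀ := by
            rw [hg, hgT]; simp only [Matrix.mul_one, Matrix.mul_assoc]
    rw [hmat]
    generalize ((u : Matrix.unitaryGroup (Fin N) ℂ) : Matrix (Fin N) (Fin N) ℂ) * X * ((u : Matrix.unitaryGroup (Fin N) ℂ) : Matrix (Fin N) (Fin N) ℂ)ᵀ = Mx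
    rw [Matrix.mul_apply, Finset.sum_mul]
    simp_rw [Matrix.mul_apply, Finset.sum_mul]
    rw [Finset.sum_comm]
    exact Finset.sum_congr rfl fun c _ => Finset.sum_congr rfl fun d _ => by ring
  simp_rw [hpt]
  rw [integral_finsetSum _ (fun c _ => ?_)]
  · refine Finset.sum_congr rfl fun c _ => ?_
    rw [integral_finsetSum _ (fun d _ => ?_)]
    · refine Finset.sum_congr rfl fun d _ => ?_
      rw [integral_mul_const, integral_const_mul]
    · exact ((integrable_congr_entry_mul_weight β X c d).const_mul _).mul_const _
  · exact integrable_finsetSum _ fun d _ => ((integrable_congr_entry_mul_weight β X c d).const_mul _).mul_const _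

/-- `(u E_{jk} uᵀ)_{ab} = u_{aj} u_{bk}`. -/
theorem congr_single_apply (U : Matrix (Fin N) (Fin N) ℂ) (j k a b : Fin N) :
    (U * Matrix.single j k (1 : ℂ) * Uᵀ) a b = U a j * U b k := by
  rw [Matrix.mul_apply, Finset.sum_eq_single_of_mem k (Finset.mem_univ k) (fun d _ hd => by
    rw [Matrix.mul_single_apply_of_ne (hbj := hd), zero_mul]),
    Matrix.mul_single_apply_same, mul_one, Matrix.transpose_apply]

/-! ### 2. The congruence channel -/

/-- **THE ONE-PLAQUETTE CONGRUENCE CHANNEL OF `U(N)`** (`N ≥ 2`, every real `β`, every `X ∈ M_N(ℂ)`):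
`∫ (u X uᵀ)_{ab} e^{βRe tr u} du = A'·X_{ab} + B'·X_{ba}` with `A' = (N s₁ − s₂)/(N(N² − 1))`,
`B' = (N s₂ − s₁)/(N(N² − 1))`, `s₁ = ∫ (tr u)² e^{βRe tr u} du`, `s₂ = ∫ tr(u²) e^{βRe tr u} du`. -/
theorem integral_unitary_congr_entry_mul_exp (hN : 2 ≤ N) (β : ℝ) (X : Matrix (Fin N) (Fin N) ℂ) (a b : Fin N) :
    ∫ u, (((u : Matrix.unitaryGroup (Fin N) ℂ) : Matrix (Fin N) (Fin N) ℂ) * X * ((u : Matrix.unitaryGroup (Fin N) ℂ) : Matrix (Fin N) (Fin N) ℂ)ᵀ) a b *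
        (Real.exp (β * ((u : Matrix.unitaryGroup (Fin N) ℂ) : Matrix (Fin N) (Fin N) ℂ).trace.re) : ℂ) ∂(haarProbability (Matrix.unitaryGroup (Fin N) ℂ))
      = ((N * (∫ u, ((u : Matrix.unitaryGroup (Fin N) ℂ) : Matrix (Fin N) (Fin N) ℂ).trace ^ 2 *
            (Real.exp (β * ((u : Matrix.unitaryGroup (Fin N) ℂ) : Matrix (Fin N) (Fin N) ℂ).trace.re) : ℂ) ∂(haarProbability (Matrix.unitaryGroup (Fin N) ℂ))) -
          (∫ u, (((u : Matrix.unitaryGroup (Fin N) ℂ) : Matrix (Fin N) (Fin N) ℂ) * ((u : Matrix.unitaryGroup (Fin N) ℂ) : Matrix (Fin N) (Fin N) ℂ)).trace *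
            (Real.exp (β * ((u : Matrix.unitaryGroup (Fin N) ℂ) : Matrix (Fin N) (Fin N) ℂ).trace.re) : ℂ) ∂(haarProbability (Matrix.unitaryGroup (Fin N) ℂ)))) /
          (N * ((N : ℂ) ^ 2 - 1))) * X a b
        + ((N * (∫ u, (((u : Matrix.unitaryGroup (Fin N) ℂ) : Matrix (Fin N) (Fin N) ℂ) * ((u : Matrix.unitaryGroup (Fin N) ℂ) : Matrix (Fin N) (Fin N) ℂ)).trace *
            (Real.exp (β * ((u : Matrix.unitaryGroup (Fin N) ℂ) : Matrix (Fin N) (Fin N) ℂ).trace.re) : ℂ) ∂(haarProbability (Matrix.unitaryGroup (Fin N) ℂ))) -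
          (∫ u, ((u : Matrix.unitaryGroup (Fin N) ℂ) : Matrix (Fin N) (Fin N) ℂ).trace ^ 2 *
            (Real.exp (β * ((u : Matrix.unitaryGroup (Fin N) ℂ) : Matrix (Fin N) (Fin N) ℂ).trace.re) : ℂ) ∂(haarProbability (Matrix.unitaryGroup (Fin N) ℂ)))) /
          (N * ((N : ℂ) ^ 2 - 1))) * X b a := by
  set s₁ : ℂ := ∫ u, ((u : Matrix.unitaryGroup (Fin N) ℂ) : Matrix (Fin N) (Fin N) ℂ).trace ^ 2 *
    (Real.exp (β * ((u : Matrix.unitaryGroup (Fin N) ℂ) : Matrix (Fin N) (Fin N) ℂ).trace.re) : ℂ) ∂(haarProbability (Matrix.unitaryGroup (Fin N) ℂ)) with hs₁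
  set s₂ : ℂ := ∫ u, (((u : Matrix.unitaryGroup (Fin N) ℂ) : Matrix (Fin N) (Fin N) ℂ) * ((u : Matrix.unitaryGroup (Fin N) ℂ) : Matrix (Fin N) (Fin N) ℂ)).trace *
    (Real.exp (β * ((u : Matrix.unitaryGroup (Fin N) ℂ) : Matrix (Fin N) (Fin N) ℂ).trace.re) : ℂ) ∂(haarProbability (Matrix.unitaryGroup (Fin N) ℂ)) with hs₂
  -- the entrywise integral as a linear map
  set T : Matrix (Fin N) (Fin N) ℂ →ₗ[ℂ] Matrix (Fin N) (Fin N) ℂ :=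
    { toFun := fun X => Matrix.of fun a b => ∫ u, (((u : Matrix.unitaryGroup (Fin N) ℂ) : Matrix (Fin N) (Fin N) ℂ) * X *
        ((u : Matrix.unitaryGroup (Fin N) ℂ) : Matrix (Fin N) (Fin N) ℂ)ᵀ) a b *
        (Real.exp (β * ((u : Matrix.unitaryGroup (Fin N) ℂ) : Matrix (Fin N) (Fin N) ℂ).trace.re) : ℂ) ∂(haarProbability (Matrix.unitaryGroup (Fin N) ℂ))
      map_add' := by
        intro X Y
        ext a b
        simp only [Matrix.of_apply, Matrix.add_apply]
        rw [← integral_add (integrable_congr_entry_mul_weight β X a b) (integrable_congr_entry_mul_weight β Y a b)]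
        refine integral_congr_ae (Eventually.of_forall fun u => ?_)
        simp only [Matrix.mul_add, Matrix.add_mul, Matrix.add_apply]
        ring
      map_smul' := by
        intro c X
        ext a b
        simp only [Matrix.of_apply, Matrix.smul_apply, smul_eq_mul, RingHom.id_apply]
        rw [← integral_const_mul]
        refine integral_congr_ae (Eventually.of_forall fun u => ?_)
        simp only [Matrix.mul_smul, Matrix.smul_mul, Matrix.smul_apply, smul_eq_mul]
        ring } with hT
  have hTapply : ∀ (Y : Matrix (Fin N) (Fin N) ℂ) (a b : Fin N), T Y a b = ∫ u, (((u : Matrix.unitaryGroup (Fin N) ℂ) : Matrix (Fin N) (Fin N) ℂ) * Y *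
      ((u : Matrix.unitaryGroup (Fin N) ℂ) : Matrix (Fin N) (Fin N) ℂ)ᵀ) a b *
      (Real.exp (β * ((u : Matrix.unitaryGroup (Fin N) ℂ) : Matrix (Fin N) (Fin N) ℂ).trace.re) : ℂ) ∂(haarProbability (Matrix.unitaryGroup (Fin N) ℂ)) :=
    fun Y a b => rfl
  -- congruence covariance
  have hcov : ∀ (g : Matrix.unitaryGroup (Fin N) ℂ) (Y : Matrix (Fin N) (Fin N) ℂ),
      T (((g : Matrix.unitaryGroup (Fin N) ℂ) : Matrix (Fin N) (Fin N) ℂ) * Y * ((g : Matrix.unitaryGroup (Fin N) ℂ) : Matrix (Fin N) (Fin N) ℂ)ᵀ)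
        = ((g : Matrix.unitaryGroup (Fin N) ℂ) : Matrix (Fin N) (Fin N) ℂ) * T Y * ((g : Matrix.unitaryGroup (Fin N) ℂ) : Matrix (Fin N) (Fin N) ℂ)ᵀ := by
    intro g Y
    ext a b
    have hR : (((g : Matrix.unitaryGroup (Fin N) ℂ) : Matrix (Fin N) (Fin N) ℂ) * T Y * ((g : Matrix.unitaryGroup (Fin N) ℂ) : Matrix (Fin N) (Fin N) ℂ)ᵀ) a b
        = ∑ c, ∑ d, ((g : Matrix.unitaryGroup (Fin N) ℂ) : Matrix (Fin N) (Fin N) ℂ) a c * T Y c d *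
            (((g : Matrix.unitaryGroup (Fin N) ℂ) : Matrix (Fin N) (Fin N) ℂ)ᵀ) d b := by
      generalize T Y = TY
      rw [Matrix.mul_apply]
      simp_rw [Matrix.mul_apply, Finset.sum_mul]
      rw [Finset.sum_comm]
    rw [hR, hTapply, integral_congr_entry_congr]
    simp only [hTapply]
  obtain ⟨A, B, hAB⟩ := linearMap_eq_of_commute_unitary_congr T hN hcov
  have hN0 : (N : ℂ) ≠ 0 := by exact_mod_cast (show N ≠ 0 by omega)
  have hN1 : ((N : ℂ) ^ 2 - 1) ≠ 0 := by
    have h2 : (2 : ℝ) ≤ N := by exact_mod_cast hN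
    have : ((N : ℝ) ^ 2 - 1) ≠ 0 := by nlinarith
    exact_mod_cast this
  have hint : ∀ j k a b : Fin N, Integrable (fun u : Matrix.unitaryGroup (Fin N) ℂ =>
      ((((u : Matrix.unitaryGroup (Fin N) ℂ) : Matrix (Fin N) (Fin N) ℂ) * Matrix.single j k 1 *
        ((u : Matrix.unitaryGroup (Fin N) ℂ) : Matrix (Fin N) (Fin N) ℂ)ᵀ : Matrix (Fin N) (Fin N) ℂ) a b) *
        (Real.exp (β * ((u : Matrix.unitaryGroup (Fin N) ℂ) : Matrix (Fin N) (Fin N) ℂ).trace.re) : ℂ)) (haarProbability (Matrix.unitaryGroup (Fin N) ℂ)) :=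
    fun j k a b => integrable_congr_entry_mul_weight β _ a b
  -- equation 1: `Σ_{jk} T(E_{jk})_{jk} = s₁ = N² A + N B`
  have hsum1 : ∑ j : Fin N, ∑ k : Fin N, T (Matrix.single j k 1) j k = s₁ := by
    rw [hs₁]
    simp_rw [hTapply]
    have hinner : ∀ j : Fin N, ∑ k : Fin N, ∫ u, ((((u : Matrix.unitaryGroup (Fin N) ℂ) : Matrix (Fin N) (Fin N) ℂ) * Matrix.single j k 1 *
        ((u : Matrix.unitaryGroup (Fin N) ℂ) : Matrix (Fin N) (Fin N) ℂ)ᵀ : Matrix (Fin N) (Fin N) ℂ) j k) *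
        (Real.exp (β * ((u : Matrix.unitaryGroup (Fin N) ℂ) : Matrix (Fin N) (Fin N) ℂ).trace.re) : ℂ) ∂(haarProbability (Matrix.unitaryGroup (Fin N) ℂ))
        = ∫ u, ∑ k : Fin N, ((((u : Matrix.unitaryGroup (Fin N) ℂ) : Matrix (Fin N) (Fin N) ℂ) * Matrix.single j k 1 *
        ((u : Matrix.unitaryGroup (Fin N) ℂ) : Matrix (Fin N) (Fin N) ℂ)ᵀ : Matrix (Fin N) (Fin N) ℂ) j k) *
        (Real.exp (β * ((u : Matrix.unitaryGroup (Fin N) ℂ) : Matrix (Fin N) (Fin N) ℂ).trace.re) : ℂ) ∂(haarProbability (Matrix.unitaryGroup (Fin N) ℂ)) :=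
      fun j => (integral_finsetSum _ (fun k _ => hint j k j k)).symm
    simp_rw [hinner]
    rw [← integral_finsetSum _ (fun j _ => integrable_finsetSum _ (fun k _ => hint j k j k))]
    refine integral_congr_ae (Eventually.of_forall fun u => ?_)
    simp_rw [congr_single_apply, ← Finset.sum_mul]
    congr 1
    rw [sq, Matrix.trace, Finset.sum_mul_sum]
    rfl
  have hsum1' : ∑ j : Fin N, ∑ k : Fin N, T (Matrix.single j k 1) j k = (N : ℂ) ^ 2 * A + N * B := by
    have hterm : ∀ j k : Fin N, T (Matrix.single j k 1) j k = A + (if j = k then B else 0) := by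
      intro j k
      rw [hAB]
      by_cases h : j = k
      · subst h; simp
      · simp [h]
    simp_rw [hterm]
    simp only [Finset.sum_add_distrib, Finset.sum_const, Finset.card_univ, Fintype.card_fin, Finset.sum_ite_eq,
      Finset.mem_univ, if_true, nsmul_eq_mul]
    ring
  -- equation 2: `Σ_{jk} T(E_{jk})_{kj} = s₂ = N A + N² B`
  have hsum2 : ∑ j : Fin N, ∑ k : Fin N, T (Matrix.single j k 1) k j = s₂ := by
    rw [hs₂]
    simp_rw [hTapply]
    have hinner : ∀ j : Fin N, ∑ k : Fin N, ∫ u, ((((u : Matrix.unitaryGroup (Fin N) ℂ) : Matrix (Fin N) (Fin N) ℂ) * Matrix.single j k 1 *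
        ((u : Matrix.unitaryGroup (Fin N) ℂ) : Matrix (Fin N) (Fin N) ℂ)ᵀ : Matrix (Fin N) (Fin N) ℂ) k j) *
        (Real.exp (β * ((u : Matrix.unitaryGroup (Fin N) ℂ) : Matrix (Fin N) (Fin N) ℂ).trace.re) : ℂ) ∂(haarProbability (Matrix.unitaryGroup (Fin N) ℂ))
        = ∫ u, ∑ k : Fin N, ((((u : Matrix.unitaryGroup (Fin N) ℂ) : Matrix (Fin N) (Fin N) ℂ) * Matrix.single j k 1 *
        ((u : Matrix.unitaryGroup (Fin N) ℂ) : Matrix (Fin N) (Fin N) ℂ)ᵀ : Matrix (Fin N) (Fin N) ℂ) k j) *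
        (Real.exp (β * ((u : Matrix.unitaryGroup (Fin N) ℂ) : Matrix (Fin N) (Fin N) ℂ).trace.re) : ℂ) ∂(haarProbability (Matrix.unitaryGroup (Fin N) ℂ)) :=
      fun j => (integral_finsetSum _ (fun k _ => hint j k k j)).symm
    simp_rw [hinner]
    rw [← integral_finsetSum _ (fun j _ => integrable_finsetSum _ (fun k _ => hint j k k j))]
    refine integral_congr_ae (Eventually.of_forall fun u => ?_)
    simp_rw [congr_single_apply, ← Finset.sum_mul]
    congr 1
    simp only [Matrix.trace, Matrix.diag_apply, Matrix.mul_apply]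
    exact Finset.sum_congr rfl fun j _ => Finset.sum_congr rfl fun k _ => mul_comm _ _
  have hsum2' : ∑ j : Fin N, ∑ k : Fin N, T (Matrix.single j k 1) k j = N * A + (N : ℂ) ^ 2 * B := by
    have hterm : ∀ j k : Fin N, T (Matrix.single j k 1) k j = (if j = k then A else 0) + B := by
      intro j k
      rw [hAB]
      by_cases h : j = k
      · subst h; simp
      · simp [h]
    simp_rw [hterm]
    simp only [Finset.sum_add_distrib, Finset.sum_const, Finset.card_univ, Fintype.card_fin, Finset.sum_ite_eq,
      Finset.mem_univ, if_true, nsmul_eq_mul]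
    ring
  have h1 : (N : ℂ) ^ 2 * A + N * B = s₁ := by rw [← hsum1', hsum1]
  have h2 : (N : ℂ) * A + (N : ℂ) ^ 2 * B = s₂ := by rw [← hsum2', hsum2]
  -- solve for `A`, `B` and conclude
  have hA : A = (N * s₁ - s₂) / (N * ((N : ℂ) ^ 2 - 1)) := by
    field_simp
    linear_combination (N : ℂ) * h1 - h2
  have hB : B = (N * s₂ - s₁) / (N * ((N : ℂ) ^ 2 - 1)) := by
    field_simp
    linear_combination (N : ℂ) * h2 - h1
  have h := congrFun (congrFun (hAB X) a) b
  rw [hTapply, Matrix.add_apply, Matrix.smul_apply, Matrix.smul_apply, smul_eq_mul, smul_eq_mul, Matrix.transpose_apply,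
    hA, hB] at h
  rw [h]

end CongruenceChannel

end Summit.Ventures.LatticeQCDFlow.Scoring
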